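import Mathlib
import Literature.Analysis.FluidPDE.SuitableWeak
import Literature.Analysis.FluidPDE.WeakGradientSlicing
import Literature.Analysis.FluidPDE.SpaceTimeRescaling
import Literature.Analysis.FluidPDE.LocalEnergyTimeShift
import Summits.NavierStokesRegularity.NavierStokesRegularity.Theorems.EulerZoomLiouvillePowerGaugeEulerLiouvilleTravelingWave
import Summits.NavierStokesRegularity.NavierStokesRegularity.Theorems.EulerZoomLiouvillePowerGaugeEulerLiouvilleTimePeriodicTools
import Summits.NavierStokesRegularity.NavierStokesRegularity.Theorems.EulerZoomLiouvillePowerGaugeEulerLiouvilleSteadyTools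
import Summits.NavierStokesRegularity.NavierStokesRegularity.Theorems.EulerZoomLiouvillePowerGaugeEulerLiouvilleAllRhoStrata
import Summits.NavierStokesRegularity.NavierStokesRegularity.Theorems.EulerZoomLiouvillePowerGaugeEulerLiouvillePastSteady
import Summits.NavierStokesRegularity.NavierStokesRegularity.Theorems.EulerZoomLiouvillePowerGaugeEulerLiouvillePastTimePeriodic
import HarnessLib

/-!
# Crux E `PowerGaugeEulerLiouville` (stmt-NavierStokesRegularity-19832): members whose PAST is a traveling wave are trivial

Route `EulerZoomLiouville` (NavierStokesRegularity), crux E = Seregin's power-gauged ancient-Euler Liouville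
statement.  The tree's traveling-wave stratum `powerGaugeEulerLiouville_travelingWave` (`…TravelingWave.lean`,
ns-typeII-p3) assumes `u(τ, y) = U(y − τ b)`, `H(τ, y) = G₀(y − τ b)` for EVERY `τ < 0`.  Here the traveling form
is assumed only in the FAR PAST, `τ < T₁` (`T₁ ≤ 0`; NOTHING on `[T₁, 0)`, no regularity beyond the class), and
the member still vanishes a.e. on the whole slab (`PastTravel.ae_eq_zero_of_gauge_of_pastTravelingWave`).
With `…PastSteady`, `…PastWeakIrrotational`, `…PastSymmetric`, `…PastTimePeriodic` this completes the PAST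
PROGRAMME of the lead skeleton `Cruxes/PowerGaugeEulerLiouville/Lines/birth.lean` (interim LEAD ns-typeII-p2 g9):
every whole-slab stratum of the tree decided by large-scale gauge arithmetic holds in its past form.

Proof (`b = 0` is the past-steady stratum).  For `b ≠ 0` time-translate the past, `H̃(s) = H(T₁ + s) =
G₁(· − s b)` with `G₁ = G₀(· − T₁ b)` (`s < 0`); the window inequality `ℓ ∫_{B(y₀,R)} |G₁|²_F ≤
∫∫_{(−n²,0)×B_n} |G₁(y − s b)|²_F` (`TravelingWave.lintegral_window_ge_of_travel`, `ℓ = (n − R − |y₀|)/|b|`) is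
combined with the `E`-gauge of the ORIGINAL member at the LARGE scale `a = n + √(−T₁) + 1` (the translated
window `(T₁ − n², T₁) × B_n` lies in `Q_a(0)`; `TimePeriodic.setLIntegral_window_le_of_gaugeE`), giving
`∫_{B(y₀,R)} |G₁|²_F ≤ 4c|b| n^{−ρ} → 0`.  So `G₁ = 0` a.e., every slice `H̃(s)`, `s < 0`, vanishes a.e., a.e.
slice of `ũ` has the zero weak derivative and is a.e. constant (`ae_eq_const_of_hasWeakFDerivOn_zero`), the
`A`-gauge kills the constant (`PastPeriodic.lintegral_slice_eq_zero_of_ae_const_of_gaugeA`): `∫ |u(τ)|² = 0` for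
a.e. `τ < T₁`, an energy-quiescent past, and `ae_eq_zero_of_gauge_of_energyVanishing_allRho` concludes.
WHAT THIS IS NOT: not NS regularity, not the crux `E` — a WEAK past stratum of it.
-/

noncomputable section

set_option linter.dupNamespace false

open MeasureTheory Set Filter Topology Metric Function TopologicalSpace
open scoped ENNReal NNReal

namespace Summit.NavierStokesRegularity.NavierStokesRegularity.Theorems.PowerGaugeEulerLiouville.PastTravel

open Literature.Analysis Literature.Analysis.FunctionSpaces Literature.Analysis.FluidPDE

/-- **Members of the power-gauged class whose FAR PAST is a traveling wave are trivial.**  Let `(u, p)` be a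
suitable weak Euler pair on `(−∞,0) × ℝ³` with weak spatial gradient `H` and gauges
`a^{2ρ} A(a) + a^{ρ} E(a) + a^{2ρ} D(a) ≤ c` (`ρ > 0`), and suppose that for every `τ < T₁` (`T₁ ≤ 0`)
`u(τ, y) = U(y − τ b)` and `H(τ, y) = G₀(y − τ b)` (steady in a frame moving with the constant velocity `b`;
`b = 0` allowed).  Then `u = 0` a.e. on the slab.  The whole-slab case `T₁ = 0` is the tree's
`powerGaugeEulerLiouville_travelingWave`; see the file docstring for the proof. [folklore] -/
theorem ae_eq_zero_of_gauge_of_pastTravelingWave {ρ : ℝ} (hρ : 0 < ρ)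
    {u : ℝ → EuclideanSpace ℝ (Fin 3) → EuclideanSpace ℝ (Fin 3)} {p : ℝ → EuclideanSpace ℝ (Fin 3) → ℝ}
    {H : ℝ → EuclideanSpace ℝ (Fin 3) → EuclideanSpace ℝ (Fin 3) →L[ℝ] EuclideanSpace ℝ (Fin 3)} {c : ℝ≥0}
    (hsw : IsSuitableWeakSolutionOn (slab (EuclideanSpace ℝ (Fin 3)) (Iio 0) isOpen_Iio) 0 0 u p)
    (hH : HasWeakSpatialGradientOn (slab (EuclideanSpace ℝ (Fin 3)) (Iio 0) isOpen_Iio) u H)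
    (hc : ∀ a : ℝ, 0 < a → ENNReal.ofReal (a ^ (2 * ρ)) * cknA a (0 : ℝ × EuclideanSpace ℝ (Fin 3)) u +
        ENNReal.ofReal (a ^ ρ) * cknE a (0 : ℝ × EuclideanSpace ℝ (Fin 3)) H +
        ENNReal.ofReal (a ^ (2 * ρ)) * cknD a (0 : ℝ × EuclideanSpace ℝ (Fin 3)) p ≤ (c : ℝ≥0∞))
    {T₁ : ℝ} (hT₁ : T₁ ≤ 0) {U : EuclideanSpace ℝ (Fin 3) → EuclideanSpace ℝ (Fin 3)}
    {G₀ : EuclideanSpace ℝ (Fin 3) → EuclideanSpace ℝ (Fin 3) →L[ℝ] EuclideanSpace ℝ (Fin 3)}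
    {b : EuclideanSpace ℝ (Fin 3)}
    (hu : ∀ τ : ℝ, τ < T₁ → u τ = fun y => U (y - τ • b))
    (hHf : ∀ τ : ℝ, τ < T₁ → H τ = fun y => G₀ (y - τ • b)) :
    uncurry u =ᵐ[volume.restrict (Iio (0 : ℝ) ×ˢ (univ : Set (EuclideanSpace ℝ (Fin 3))))] 0 := by
  by_cases hb : b = 0
  · -- the past-steady stratum
    subst hb
    refine PastSteady.ae_eq_zero_of_gauge_of_pastSteady hρ hsw hH hc hT₁ (v := U) fun τ hτ => ?_
    rw [hu τ hτ]
    funext y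
    simp
  have hbpos : 0 < ‖b‖ := norm_pos_iff.2 hb
  have hE : ∀ a : ℝ, 0 < a →
      ENNReal.ofReal (a ^ ρ) * cknE a (0 : ℝ × EuclideanSpace ℝ (Fin 3)) H ≤ (c : ℝ≥0∞) :=
    fun a ha => le_trans (le_trans le_add_self le_self_add) (hc a ha)
  have hA : ∀ a : ℝ, 0 < a → ENNReal.ofReal (a ^ (2 * ρ)) *
      cknA a (0 : ℝ × EuclideanSpace ℝ (Fin 3)) u ≤ (c : ℝ≥0∞) :=
    fun a ha => le_trans (le_trans le_self_add le_self_add) (hc a ha)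
  have hprod : ∀ S : Set ℝ, (volume : Measure (ℝ × EuclideanSpace ℝ (Fin 3))).restrict
      (S ×ˢ (univ : Set (EuclideanSpace ℝ (Fin 3)))) =
      (volume.restrict S).prod (volume : Measure (EuclideanSpace ℝ (Fin 3))) := by
    intro S
    rw [Measure.volume_eq_prod, Measure.restrict_prod_eq_prod_univ]
  -- ## (1) the time-translated past and its traveling profile `G₁ = G₀(· − T₁ b)`
  set ut : ℝ → EuclideanSpace ℝ (Fin 3) → EuclideanSpace ℝ (Fin 3) := fun s y => u (T₁ + s) y with hut
  set Ht : ℝ → EuclideanSpace ℝ (Fin 3) → EuclideanSpace ℝ (Fin 3) →L[ℝ] EuclideanSpace ℝ (Fin 3) :=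
    fun s y => H (T₁ + s) y with hHt
  have hHt_grad : HasWeakSpatialGradientOn (slab (EuclideanSpace ℝ (Fin 3)) (Iio 0) isOpen_Iio) ut Ht := by
    have h1 := hH.stRescale 1 one_pos one_pos T₁ (0 : EuclideanSpace ℝ (Fin 3))
    have e1 : (1 : ℝ) • stPull 1 1 T₁ (0 : EuclideanSpace ℝ (Fin 3)) u = ut := by
      funext s y
      simp [hut, stPull_apply]
    have e2 : ((1 : ℝ) * 1) • stPull 1 1 T₁ (0 : EuclideanSpace ℝ (Fin 3)) H = Ht := by
      funext s y
      simp [hHt, stPull_apply]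
    rw [e1, e2] at h1
    refine h1.mono ?_
    intro z hz
    have hz' : z.1 < 0 := by simpa [mem_slab] using hz
    rw [mem_stPreimage, mem_slab]
    simp only [stAffine_fst, one_mul, mem_Iio]
    linarith
  set G₁ : EuclideanSpace ℝ (Fin 3) → EuclideanSpace ℝ (Fin 3) →L[ℝ] EuclideanSpace ℝ (Fin 3) :=
    fun y => G₀ (y - T₁ • b) with hG₁
  have hHt_eq : ∀ s : ℝ, s < 0 → ∀ y, Ht s y = G₁ (y - s • b) := by
    intro s hs y
    show H (T₁ + s) y = G₀ (y - s • b - T₁ • b)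
    rw [hHf (T₁ + s) (by linarith)]
    show G₀ (y - (T₁ + s) • b) = G₀ (y - s • b - T₁ • b)
    congr 1
    rw [add_smul]
    abel
  -- the sheared density and its measurability on windows
  set Fs : ℝ × EuclideanSpace ℝ (Fin 3) → ℝ≥0∞ :=
    fun z => ENNReal.ofReal (frobeniusNormSq (G₁ (z.2 - z.1 • b))) with hFs
  have hFs_m : ∀ a : ℝ, 0 < a → AEMeasurable Fs
      (volume.restrict (Ioo (-(a ^ 2)) 0 ×ˢ ball (0 : EuclideanSpace ℝ (Fin 3)) a)) := by
    intro a _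
    have hsub : Ioo (-(a ^ 2)) 0 ×ˢ ball (0 : EuclideanSpace ℝ (Fin 3)) a ⊆
        ((slab (EuclideanSpace ℝ (Fin 3)) (Iio 0) isOpen_Iio : Opens _) :
          Set (ℝ × EuclideanSpace ℝ (Fin 3))) := by
      rw [coe_slab]
      exact prod_mono Ioo_subset_Iio_self (subset_univ _)
    have h1 : AEStronglyMeasurable (uncurry Ht)
        (volume.restrict (Ioo (-(a ^ 2)) 0 ×ˢ ball (0 : EuclideanSpace ℝ (Fin 3)) a)) :=
      hHt_grad.locallyIntegrableOn_grad.aestronglyMeasurable.mono_measure (Measure.restrict_mono hsub le_rfl)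
    have h2 : AEMeasurable (fun z : ℝ × EuclideanSpace ℝ (Fin 3) => ENNReal.ofReal (frobeniusNormSq (Ht z.1 z.2)))
        (volume.restrict (Ioo (-(a ^ 2)) 0 ×ˢ ball (0 : EuclideanSpace ℝ (Fin 3)) a)) :=
      ((ENNReal.continuous_ofReal.comp LerayHopfProofs.continuous_frobeniusNormSq).comp_aestronglyMeasurable
        h1).aemeasurable
    refine h2.congr ?_
    rw [Filter.EventuallyEq, ae_restrict_iff' (measurableSet_Ioo.prod measurableSet_ball)]
    refine Eventually.of_forall fun z hz => ?_
    show ENNReal.ofReal (frobeniusNormSq (Ht z.1 z.2)) = ENNReal.ofReal (frobeniusNormSq (G₁ (z.2 - z.1 • b)))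
    rw [hHt_eq z.1 hz.1.2 z.2]
  -- ## (2) the large-scale window bound from the `E`-gauge of `H`
  have hwin : ∀ T R a : ℝ, 0 < a → R ≤ a → T - T₁ ≤ a ^ 2 → 0 ≤ T →
      ∫⁻ z in Ioo (-T) 0 ×ˢ ball (0 : EuclideanSpace ℝ (Fin 3)) R, Fs z ≤
        ENNReal.ofReal ((c : ℝ) * a ^ (1 - ρ)) := by
    intro T R a ha hRa hTa hT0
    have h0 : ∫⁻ z in Ioo (-T) 0 ×ˢ ball (0 : EuclideanSpace ℝ (Fin 3)) R, Fs z =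
        ∫⁻ z in Ioo (-T) 0 ×ˢ ball (0 : EuclideanSpace ℝ (Fin 3)) R,
          (fun w : ℝ × EuclideanSpace ℝ (Fin 3) => ENNReal.ofReal (frobeniusNormSq (H w.1 w.2))) (T₁ + z.1, z.2) := by
      refine setLIntegral_congr_fun (measurableSet_Ioo.prod measurableSet_ball) fun z hz => ?_
      show ENNReal.ofReal (frobeniusNormSq (G₁ (z.2 - z.1 • b))) = ENNReal.ofReal (frobeniusNormSq (H (T₁ + z.1) z.2))
      rw [← hHt_eq z.1 hz.1.2 z.2]
    rw [h0]
    have h1 := setLIntegral_prod_timeShift T₁ (T₁ - T) T₁ (ball (0 : EuclideanSpace ℝ (Fin 3)) R)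
      (fun w : ℝ × EuclideanSpace ℝ (Fin 3) => ENNReal.ofReal (frobeniusNormSq (H w.1 w.2)))
    rw [show T₁ - T - T₁ = -T by ring, show T₁ - T₁ = (0 : ℝ) by ring] at h1
    rw [h1]
    have hsub : Ioo (T₁ - T) T₁ ×ˢ ball (0 : EuclideanSpace ℝ (Fin 3)) R ⊆
        Ioo (-(T - T₁)) 0 ×ˢ ball (0 : EuclideanSpace ℝ (Fin 3)) R :=
      prod_mono (Ioo_subset_Ioo (by linarith) hT₁) le_rfl
    refine (lintegral_mono_set hsub).trans ?_
    exact TimePeriodic.setLIntegral_window_le_of_gaugeE ha hRa hTa (hE a ha)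
  -- ## (3) every ball energy of `G₁` vanishes
  set K' : ℝ := Real.sqrt (-T₁) + 1 with hK'
  have hK'1 : 1 ≤ K' := by have := Real.sqrt_nonneg (-T₁); linarith
  have hK'sq : -T₁ ≤ K' ^ 2 := by
    have h1 : Real.sqrt (-T₁) ^ 2 = -T₁ := Real.sq_sqrt (by linarith)
    nlinarith [Real.sqrt_nonneg (-T₁)]
  have hball : ∀ (y₀ : EuclideanSpace ℝ (Fin 3)) (R : ℝ), 0 < R →
      ∫⁻ y in ball y₀ R, ENNReal.ofReal (frobeniusNormSq (G₁ y)) = 0 := by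
    -- adapted from Theorems/EulerZoomLiouvillePowerGaugeEulerLiouvilleTravelingWave.lean (`ball_grad_eq_zero_of_travel`)
    intro y₀ R hR
    set Z : ℝ≥0∞ := ∫⁻ y in ball y₀ R, ENNReal.ofReal (frobeniusNormSq (G₁ y)) with hZ
    set K : ℝ := R + ‖y₀‖ with hK
    have hK0 : 0 < K := by have := norm_nonneg y₀; linarith
    have key : ∀ᶠ n : ℕ in atTop, Z ≤ ENNReal.ofReal (4 * (c : ℝ) * ‖b‖ * (n : ℝ) ^ (-ρ)) := by
      have hev : ∀ᶠ n : ℕ in atTop, max (max (2 * K) (1 / ‖b‖ + K)) K' ≤ (n : ℝ) :=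
        tendsto_natCast_atTop_atTop.eventually_ge_atTop _
      filter_upwards [hev] with n hn
      have h2K : 2 * K ≤ n := le_trans ((le_max_left _ _).trans (le_max_left _ _)) hn
      have h1b : 1 / ‖b‖ + K ≤ n := le_trans ((le_max_right _ _).trans (le_max_left _ _)) hn
      have hnK' : K' ≤ n := le_trans (le_max_right _ _) hn
      have hn0 : (0 : ℝ) < n := by linarith
      set ℓ : ℝ := ((n : ℝ) - K) / ‖b‖ with hℓ
      have hℓpos : 0 < ℓ := div_pos (by linarith) hbpos
      have hℓa : ℓ ≤ (n : ℝ) ^ 2 := by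
        rw [hℓ, div_le_iff₀ hbpos]
        have h1 : 1 ≤ ‖b‖ * n := by
          have : 1 / ‖b‖ ≤ n := by linarith
          rwa [div_le_iff₀ hbpos, mul_comm] at this
        nlinarith
      have hfit : ‖y₀‖ + ℓ * ‖b‖ + R ≤ n := by
        rw [hℓ, div_mul_cancel₀ _ hbpos.ne']
        linarith
      have h1 := TravelingWave.lintegral_window_ge_of_travel (G₀ := G₁) (hFs_m n hn0) hℓa hfit
      -- the large scale `a = n + K'`
      set a : ℝ := (n : ℝ) + K' with ha
      have ha0 : 0 < a := by linarith
      have hna : (n : ℝ) ≤ a := by linarith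
      have ha2n : a ≤ 2 * n := by linarith
      have hTa : (n : ℝ) ^ 2 - T₁ ≤ a ^ 2 := by nlinarith
      have h2 := hwin ((n : ℝ) ^ 2) n a ha0 hna hTa (by positivity)
      have h3 : ENNReal.ofReal ℓ * Z ≤ ENNReal.ofReal ((c : ℝ) * a ^ (1 - ρ)) := h1.trans h2
      have h4 : Z ≤ ENNReal.ofReal ((c : ℝ) * a ^ (1 - ρ)) / ENNReal.ofReal ℓ := by
        rw [ENNReal.le_div_iff_mul_le (Or.inl (ENNReal.ofReal_pos.2 hℓpos).ne') (Or.inl ENNReal.ofReal_ne_top),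
          mul_comm]
        exact h3
      refine h4.trans ?_
      rw [← ENNReal.ofReal_div_of_pos hℓpos]
      refine ENNReal.ofReal_le_ofReal ?_
      -- `c a^{1-ρ} / ℓ ≤ 4 c ‖b‖ n^{-ρ}`: `a^{1-ρ} = a · a^{-ρ} ≤ 2n · n^{-ρ}`, `ℓ ‖b‖ = n - K ≥ n/2`
      have hsplit : a ^ (1 - ρ) = a * a ^ (-ρ) := by
        rw [show (1 - ρ : ℝ) = 1 + -ρ by ring, Real.rpow_add ha0, Real.rpow_one]
      have hmono : a ^ (-ρ) ≤ (n : ℝ) ^ (-ρ) := Real.rpow_le_rpow_of_nonpos hn0 hna (by linarith)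
      have hnρ : 0 ≤ (n : ℝ) ^ (-ρ) := Real.rpow_nonneg hn0.le _
      have hc0 : (0 : ℝ) ≤ c := c.coe_nonneg
      have h5 : (c : ℝ) * a ^ (1 - ρ) ≤ 2 * (c : ℝ) * n * (n : ℝ) ^ (-ρ) := by
        rw [hsplit]
        calc (c : ℝ) * (a * a ^ (-ρ)) ≤ (c : ℝ) * ((2 * n) * (n : ℝ) ^ (-ρ)) := by
              gcongr
          _ = 2 * (c : ℝ) * n * (n : ℝ) ^ (-ρ) := by ring
      rw [hℓ, div_div_eq_mul_div, div_le_iff₀ (by linarith : (0 : ℝ) < n - K)]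
      have h6 : (c : ℝ) * a ^ (1 - ρ) * ‖b‖ ≤ 2 * (c : ℝ) * n * (n : ℝ) ^ (-ρ) * ‖b‖ := by gcongr
      have hx : 0 ≤ (c : ℝ) * ‖b‖ * (n : ℝ) ^ (-ρ) := by positivity
      have h7 : 2 * (c : ℝ) * n * (n : ℝ) ^ (-ρ) * ‖b‖ ≤ 4 * (c : ℝ) * ‖b‖ * (n : ℝ) ^ (-ρ) * ((n : ℝ) - K) :=
        calc 2 * (c : ℝ) * n * (n : ℝ) ^ (-ρ) * ‖b‖ = ((c : ℝ) * ‖b‖ * (n : ℝ) ^ (-ρ)) * (2 * n) := by ring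
          _ ≤ ((c : ℝ) * ‖b‖ * (n : ℝ) ^ (-ρ)) * (4 * ((n : ℝ) - K)) := by
              apply mul_le_mul_of_nonneg_left _ hx
              linarith
          _ = 4 * (c : ℝ) * ‖b‖ * (n : ℝ) ^ (-ρ) * ((n : ℝ) - K) := by ring
      linarith
    have hlim : Tendsto (fun n : ℕ => ENNReal.ofReal (4 * (c : ℝ) * ‖b‖ * (n : ℝ) ^ (-ρ))) atTop (𝓝 0) := by
      have h1 : Tendsto (fun n : ℕ => ((n : ℝ)) ^ (-ρ)) atTop (𝓝 0) :=
        (tendsto_rpow_neg_atTop hρ).comp tendsto_natCast_atTop_atTop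
      have h2 := h1.const_mul (4 * (c : ℝ) * ‖b‖)
      rw [mul_zero] at h2
      have h3 := ENNReal.tendsto_ofReal h2
      rwa [ENNReal.ofReal_zero] at h3
    exact le_antisymm (le_of_tendsto_of_tendsto tendsto_const_nhds hlim key) bot_le
  -- ## (4) slices of `ũ`, and `G₁ = 0` a.e.
  have hsliceT : ∀ᵐ s ∂(volume.restrict (Iio (0 : ℝ))),
      HasWeakFDerivOn (⊤ : Opens (EuclideanSpace ℝ (Fin 3))) volume (ut s) (Ht s) := by
    have hcov : Iio (0 : ℝ) = ⋃ N : ℕ, Ioo (-((N : ℝ) + 1)) 0 := by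
      refine subset_antisymm (fun t ht => ?_) (iUnion_subset fun n t ht => ht.2)
      obtain ⟨n, hn⟩ := exists_nat_gt (-t)
      exact mem_iUnion.2 ⟨n, ⟨by linarith, ht⟩⟩
    rw [hcov, ae_restrict_iUnion_iff]
    intro N
    have hmono : slab (EuclideanSpace ℝ (Fin 3)) (Ioo (-((N : ℝ) + 1)) 0) isOpen_Ioo ≤
        slab (EuclideanSpace ℝ (Fin 3)) (Iio 0) isOpen_Iio := slab_mono Ioo_subset_Iio_self
    exact (hHt_grad.mono hmono).ae_hasWeakFDerivOn_slice (Ω := ⊤)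
  have hs0 : ∀ᵐ s ∂(volume.restrict (Iio (0 : ℝ))), s < 0 := by
    rw [ae_restrict_iff' measurableSet_Iio]
    exact Eventually.of_forall fun s hs => hs
  haveI : (ae (volume.restrict (Iio (0 : ℝ)))).NeBot := by
    rw [ae_neBot, Ne, Measure.restrict_eq_zero, Real.volume_Iio]
    exact ENNReal.top_ne_zero
  obtain ⟨s₀, hs₀W, hs₀0⟩ := (hsliceT.and hs0).exists
  have hG₁m : AEStronglyMeasurable G₁ volume := by
    have h1 : AEStronglyMeasurable (Ht s₀) volume := by
      have h := hs₀W.locallyIntegrableOn_deriv.aestronglyMeasurable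
      rwa [Opens.coe_top, Measure.restrict_univ] at h
    have h2 : Ht s₀ = fun y => G₁ (y - s₀ • b) := funext (hHt_eq s₀ hs₀0)
    rw [h2] at h1
    have h3 := h1.comp_quasiMeasurePreserving
      ((measurePreserving_add_right volume (s₀ • b)).quasiMeasurePreserving)
    have h4 : ((fun y : EuclideanSpace ℝ (Fin 3) => G₁ (y - s₀ • b)) ∘ fun y : EuclideanSpace ℝ (Fin 3) => y + s₀ • b) = G₁ := by
      funext y
      simp
    rw [h4] at h3
    exact h3
  have hG₁0 : G₁ =ᵐ[volume] 0 := by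
    have hballae : ∀ n : ℕ, ∀ᵐ y ∂volume, y ∈ ball (0 : EuclideanSpace ℝ (Fin 3)) ((n : ℝ) + 1) → G₁ y = 0 := by
      intro n
      have hmeas : AEMeasurable (fun y => ENNReal.ofReal (frobeniusNormSq (G₁ y)))
          (volume.restrict (ball (0 : EuclideanSpace ℝ (Fin 3)) ((n : ℝ) + 1))) :=
        ((ENNReal.continuous_ofReal.comp LerayHopfProofs.continuous_frobeniusNormSq).comp_aestronglyMeasurable
          hG₁m.restrict).aemeasurable
      have h := (lintegral_eq_zero_iff' hmeas).1 (hball 0 _ (by positivity))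
      rw [Filter.EventuallyEq, ae_restrict_iff' measurableSet_ball] at h
      filter_upwards [h] with y hy hyb
      have h1 : frobeniusNormSq (G₁ y) ≤ 0 := by simpa using hy hyb
      have h2 : ‖G₁ y‖ ^ 2 ≤ 0 := (sq_opNorm_le_frobeniusNormSq _).trans h1
      exact norm_eq_zero.1 (by nlinarith [norm_nonneg (G₁ y)])
    filter_upwards [ae_all_iff.2 hballae] with y hy
    obtain ⟨n, hn⟩ := exists_nat_gt ‖y‖
    exact hy n (by rw [mem_ball_zero_iff]; linarith)
  -- ## (5) a.e. slice of `ũ` has the zero weak derivative, is a.e. constant, has zero energy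
  have henergyT : ∀ᵐ s ∂(volume.restrict (Iio (0 : ℝ))), ∫⁻ x, ‖u (T₁ + s) x‖ₑ ^ 2 = 0 := by
    filter_upwards [hsliceT, hs0] with s hW hs
    have hz : Ht s =ᵐ[volume] 0 := by
      have h1 : Ht s = fun y => G₁ (y - s • b) := funext (hHt_eq s hs)
      rw [h1]
      have h2 := ((measurePreserving_sub_right volume (s • b)).quasiMeasurePreserving).ae_eq_comp hG₁0
      filter_upwards [h2] with y hy
      simpa [Function.comp_def] using hy
    have hW0 : HasWeakFDerivOn (⊤ : Opens (EuclideanSpace ℝ (Fin 3))) volume (ut s) 0 :=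
      { locallyIntegrableOn := hW.locallyIntegrableOn
        locallyIntegrableOn_deriv :=
          (locallyIntegrable_const (0 : EuclideanSpace ℝ (Fin 3) →L[ℝ] EuclideanSpace ℝ (Fin 3))
            ).locallyIntegrableOn _
        integral_fderiv_smul_eq := fun φ w hφ => by
          rw [hW.integral_fderiv_smul_eq φ w hφ]
          congr 1
          refine integral_congr_ae ?_
          filter_upwards [ae_restrict_of_ae hz] with y hy
          simp [hy] }
    obtain ⟨b₀, hb₀⟩ := ae_eq_const_of_hasWeakFDerivOn_zero hW0
    have hτ : T₁ + s < 0 := by linarith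
    exact PastPeriodic.lintegral_slice_eq_zero_of_ae_const_of_gaugeA hρ hA hτ hb₀
  -- ## (6) back to `u`: energy-quiescent past
  have hnullT : volume ({s : ℝ | ¬ ∫⁻ x, ‖u (T₁ + s) x‖ₑ ^ 2 = 0} ∩ Iio 0) = 0 := by
    have h := henergyT
    rw [ae_iff, Measure.restrict_apply' measurableSet_Iio] at h
    exact h
  have hnull : volume ({τ : ℝ | ¬ ∫⁻ x, ‖u τ x‖ₑ ^ 2 = 0} ∩ Iio T₁) = 0 := by
    have hpre : (fun s : ℝ => T₁ + s) ⁻¹' ({τ : ℝ | ¬ ∫⁻ x, ‖u τ x‖ₑ ^ 2 = 0} ∩ Iio T₁) =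
        {s : ℝ | ¬ ∫⁻ x, ‖u (T₁ + s) x‖ₑ ^ 2 = 0} ∩ Iio 0 := by
      ext s
      simp only [preimage_inter, preimage_setOf_eq, mem_inter_iff, mem_setOf_eq, mem_preimage, mem_Iio]
      constructor
      · rintro ⟨h1, h2⟩; exact ⟨h1, by linarith⟩
      · rintro ⟨h1, h2⟩; exact ⟨h1, by linarith⟩
    rw [← measure_preimage_add volume T₁, hpre]
    exact hnullT
  refine ae_eq_zero_of_gauge_of_energyVanishing_allRho hρ.le hsw hH hc fun ε _ N => ?_
  set m : ℝ := min (-N) T₁ with hm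
  intro h0
  have hsub : Iio m ⊆ {s : ℝ | s < -N ∧ ∫⁻ x, ‖u s x‖ₑ ^ 2 ≤ ENNReal.ofReal ε} ∪
      ({τ : ℝ | ¬ ∫⁻ x, ‖u τ x‖ₑ ^ 2 = 0} ∩ Iio T₁) := by
    intro s hs
    have hsN : s < -N := lt_of_lt_of_le hs (min_le_left _ _)
    have hsT : s < T₁ := lt_of_lt_of_le hs (min_le_right _ _)
    by_cases hz : ∫⁻ x, ‖u s x‖ₑ ^ 2 = 0
    · left
      refine ⟨hsN, ?_⟩
      rw [hz]
      exact zero_le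
    · right
      exact ⟨hz, hsT⟩
  have h2 : volume (Iio m) ≤ 0 :=
    calc volume (Iio m) ≤ volume ({s : ℝ | s < -N ∧ ∫⁻ x, ‖u s x‖ₑ ^ 2 ≤ ENNReal.ofReal ε} ∪
          ({τ : ℝ | ¬ ∫⁻ x, ‖u τ x‖ₑ ^ 2 = 0} ∩ Iio T₁)) := measure_mono hsub
      _ ≤ volume {s : ℝ | s < -N ∧ ∫⁻ x, ‖u s x‖ₑ ^ 2 ≤ ENNReal.ofReal ε} +
          volume ({τ : ℝ | ¬ ∫⁻ x, ‖u τ x‖ₑ ^ 2 = 0} ∩ Iio T₁) := measure_union_le _ _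
      _ = 0 := by rw [h0, hnull, add_zero]
  rw [Real.volume_Iio] at h2
  exact absurd h2 (by simp)

end Summit.NavierStokesRegularity.NavierStokesRegularity.Theorems.PowerGaugeEulerLiouville.PastTravel
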